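/-
Copyright: the b2b-balaban T⁴-continuum CRUX team, row NE7b OWNER lineage `t4-ne7b-p1` (gen 136). Project licence.
-/
import Literature.MathematicalPhysics.QuantumFieldTheory.GaussianToolkit

/-!
# THE UPPER SECOND-ORDER LETTER PASSES THROUGH ANY FLUCTUATION INTEGRAL — (β1)'s FIRST BRICK, FOR BLOCK-LOCAL POTENTIALS: for ANY
# measure `μ`, ANY potential `U` on `ℝ^ι` with an upper letter along the shift `δ`,
#   `U(φ + δ) ≤ U(φ) + D(φ) + c`   for all `φ`   (`D(φ)` = the directional derivative `DU(φ)[δ]`, `c = ½Λ·q(δ)` on the road),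
# the effective potential `W(ψ) = −log ∫e^{−U(ω+ψ)}dμ(ω)` obeys
#   `W(ψ + δ) ≤ W(ψ) + ⟨D(·+ψ)⟩_{ν_ψ} + c`,   `⟨G⟩_{ν_ψ} = ∫e^{−U(ω+ψ)}G(ω)dμ ∕ ∫e^{−U(ω+ψ)}dμ`
# — (316)'s mechanism with NO single-site structure, NO Gaussian, NO Jensen from the library: the tangent line of `exp` at the tilted mean
# (`e^{x} ≥ e^{a}(1 + x − a)`) integrates to the bound.  On the road `⟨DU(·+ψ)[δ]⟩_{ν_ψ} = DW(ψ)[δ]` ((313), and its block-local twin to come), so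
# this IS the upper half of the two-sided second-order class for the NEXT potential of a BLOCK-local input (row NE7b, node U5c; [folklore])

Cell `pub-balaban`, sub-cell `t4`, spine estimate NE7b (`T4WeightBudget.RelWeightBound`; the cell's OWN estimate — NOT PRINTED in
[Bałaban 1983–89], NOT PROVED).  Crux-route work under `Spine/NE7b/` by the row OWNER (`t4-ne7b-p1` gen 136, file (397)) under FREEZE
(0)'s crux-prover clause, on this gen's SCOPING-d8 (β1) («the class after one step is BLOCK-local; re-run (316)∕(318) for block-local V»);
NOTHING of Bałaban's is named as a Lean object, valued or asserted; no `T4Continuum/Support` leaf typed; no `def`, no notation; zero `sorry`.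
Imports: the tree's `GaussianToolkit` for the ambient instances only; Mathlib's `Real.add_one_le_exp`, `integral_mono`, `Real.log_le_log`.

WHAT IS PROVED ([folklore]):
* §1 `integral_exp_neg_ge_of_upper`, **`neg_log_upper_transfer`** (ABSTRACT: `F′ ≤ F + G + c` pointwise, `e^{−F}`, `e^{−F}G`, `e^{−F′}` integrable, `0 < ∫e^{−F}` ⟹
  `e^{−c−a}∫e^{−F} ≤ ∫e^{−F′}` with `a = ∫e^{−F}G ∕ ∫e^{−F}`, hence `0 < ∫e^{−F′}` and `−log∫e^{−F′} ≤ −log∫e^{−F} + a + c`);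
* §2 THE BLOCK READING **`block_upper_letter`**: for `U : ℝ^ι → ℝ`, any `D : ℝ^ι → ℝ`, `c : ℝ` with `U(φ+δ) ≤ U(φ) + D(φ) + c` for all `φ`:
  `−log∫e^{−U(ω+(ψ+δ))}dμ ≤ −log∫e^{−U(ω+ψ)}dμ + (∫e^{−U(ω+ψ)}D(ω+ψ)dμ)∕(∫e^{−U(ω+ψ)}dμ) + c`; §3 toy.

HONEST (what this is NOT).  The upper half only; the identification of the tilted mean with `DW(ψ)[δ]` (dominated differentiation for block
functionals) and the LOWER half (Prékopa–Leindler, (317)∕(318)'s mechanism) are the successor's; integrability letters are hypotheses (on the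
road: the Gaussian regulator (288)∕(297)); scalar skeleton ((A3), NC-NE7b-α UNRULED); nothing of Bałaban's asserted.  BY-NAME EFFECT ON THE
WALL: NONE.  NE7b NOT PRINTED ∕ NOT PROVED; spine PROVED 0∕9; rung (B)+1 — the programme's measures remain FINITE-torus statements; NOT the mass
gap, NOT Clay.  HONEST DEPENDENCY: continuum YM on T⁴ ⇐ BetaPertH ∧ nine spine estimates (0∕9 proved); BetaPertH ⇐ (D1) ∧ (D4) ∧ CAP+tail;
G-an2-4 gates asym, D1 and NE2∕3∕4.
-/

set_option autoImplicit false

noncomputable section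

namespace Summit.QuantumFields.BalabanUV.T4Continuum.NE7b.SupBlockUpperLetterTransfer

open MeasureTheory Real

/-! ## §1. The abstract transfer (the tangent line of `exp` at the tilted mean, integrated) -/

section Abstract

variable {α : Type*} [MeasurableSpace α] {μ : Measure α}

/-- **THE UPPER LETTER PASSES THROUGH THE INTEGRAL** (abstract).  `F′ ≤ F + G + c` pointwise, `e^{−F}`, `e^{−F}·G`, `e^{−F′}` integrable,
`0 < Z = ∫e^{−F}` ⟹ with `a = (∫e^{−F}G)∕Z`: `e^{−c−a}·Z ≤ ∫e^{−F′}`. [folklore] -/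
theorem integral_exp_neg_ge_of_upper {F F' G : α → ℝ} {c : ℝ} (hle : ∀ ω, F' ω ≤ F ω + G ω + c)
    (hF : Integrable (fun ω => Real.exp (-F ω)) μ) (hFG : Integrable (fun ω => Real.exp (-F ω) * G ω) μ)
    (hF' : Integrable (fun ω => Real.exp (-F' ω)) μ) (hZ : 0 < ∫ ω, Real.exp (-F ω) ∂μ) :
    Real.exp (-c - (∫ ω, Real.exp (-F ω) * G ω ∂μ) / (∫ ω, Real.exp (-F ω) ∂μ)) * ∫ ω, Real.exp (-F ω) ∂μ ≤
      ∫ ω, Real.exp (-F' ω) ∂μ := by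
  set Z := ∫ ω, Real.exp (-F ω) ∂μ with hZdef
  set a := (∫ ω, Real.exp (-F ω) * G ω ∂μ) / Z with ha
  -- the integrable minorant `e^{−c−a}·e^{−F}(1 + a − G)`
  have hlow : Integrable (fun ω => Real.exp (-c - a) * (Real.exp (-F ω) * (1 + (a - G ω)))) μ := by
    have h1 : Integrable (fun ω => Real.exp (-F ω) * (1 + (a - G ω))) μ := by
      have e : (fun ω => Real.exp (-F ω) * (1 + (a - G ω))) = fun ω => (1 + a) * Real.exp (-F ω) - Real.exp (-F ω) * G ω := by
        funext ω; ring
      rw [e]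
      exact (hF.const_mul _).sub hFG
    exact h1.const_mul _
  have hpt : ∀ ω, Real.exp (-c - a) * (Real.exp (-F ω) * (1 + (a - G ω))) ≤ Real.exp (-F' ω) := fun ω => by
    have h1 : Real.exp (-(F ω + G ω + c)) ≤ Real.exp (-F' ω) := Real.exp_le_exp.2 (by linarith [hle ω])
    -- the tangent line of `exp` at `−c−a−F(ω)`: `e^{y}(1 + (x − y)) ≤ e^{x}`
    have h2 : Real.exp (-c - a - F ω) * (1 + (-(F ω + G ω + c) - (-c - a - F ω))) ≤ Real.exp (-(F ω + G ω + c)) := by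
      have h := Real.add_one_le_exp (-(F ω + G ω + c) - (-c - a - F ω))
      have e : Real.exp (-(F ω + G ω + c)) = Real.exp (-c - a - F ω) * Real.exp (-(F ω + G ω + c) - (-c - a - F ω)) := by
        rw [← Real.exp_add]; congr 1; ring
      rw [e]
      exact mul_le_mul_of_nonneg_left (by linarith) (Real.exp_pos _).le
    have e3 : Real.exp (-c - a) * (Real.exp (-F ω) * (1 + (a - G ω))) =
        Real.exp (-c - a - F ω) * (1 + (-(F ω + G ω + c) - (-c - a - F ω))) := by
      rw [show -c - a - F ω = (-c - a) + (-F ω) by ring, Real.exp_add]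
      ring
    rw [e3]
    exact h2.trans h1
  have hmono := integral_mono hlow hF' hpt
  -- the minorant integrates to `e^{−c−a}·Z`
  have hval : ∫ ω, Real.exp (-c - a) * (Real.exp (-F ω) * (1 + (a - G ω))) ∂μ = Real.exp (-c - a) * Z := by
    rw [integral_const_mul]
    congr 1
    have e : (fun ω => Real.exp (-F ω) * (1 + (a - G ω))) = fun ω => (1 + a) * Real.exp (-F ω) - Real.exp (-F ω) * G ω := by
      funext ω; ring
    rw [e, integral_sub (hF.const_mul _) hFG, integral_const_mul, ← hZdef]
    have haZ : ∫ ω, Real.exp (-F ω) * G ω ∂μ = a * Z := by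
      rw [ha, div_mul_cancel₀ _ hZ.ne']
    rw [haZ]; ring
  rw [hval] at hmono
  exact hmono

/-- **THE EFFECTIVE POTENTIAL'S UPPER LETTER** (abstract): under the same hypotheses, `0 < ∫e^{−F′}` and
`−log∫e^{−F′} ≤ −log∫e^{−F} + (∫e^{−F}G)∕(∫e^{−F}) + c`. [folklore] -/
theorem neg_log_upper_transfer {F F' G : α → ℝ} {c : ℝ} (hle : ∀ ω, F' ω ≤ F ω + G ω + c)
    (hF : Integrable (fun ω => Real.exp (-F ω)) μ) (hFG : Integrable (fun ω => Real.exp (-F ω) * G ω) μ)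
    (hF' : Integrable (fun ω => Real.exp (-F' ω)) μ) (hZ : 0 < ∫ ω, Real.exp (-F ω) ∂μ) :
    0 < ∫ ω, Real.exp (-F' ω) ∂μ ∧
      -Real.log (∫ ω, Real.exp (-F' ω) ∂μ) ≤
        -Real.log (∫ ω, Real.exp (-F ω) ∂μ) + (∫ ω, Real.exp (-F ω) * G ω ∂μ) / (∫ ω, Real.exp (-F ω) ∂μ) + c := by
  have h := integral_exp_neg_ge_of_upper hle hF hFG hF' hZ
  have hpos : 0 < Real.exp (-c - (∫ ω, Real.exp (-F ω) * G ω ∂μ) / (∫ ω, Real.exp (-F ω) ∂μ)) * ∫ ω, Real.exp (-F ω) ∂μ :=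
    mul_pos (Real.exp_pos _) hZ
  have hZ' : 0 < ∫ ω, Real.exp (-F' ω) ∂μ := lt_of_lt_of_le hpos h
  refine ⟨hZ', ?_⟩
  have hlog := Real.log_le_log hpos h
  rw [Real.log_mul (Real.exp_pos _).ne' hZ.ne', Real.log_exp] at hlog
  linarith

end Abstract

/-! ## §2. The block reading: a potential on `ℝ^ι` shifted by the external field -/

section Block

variable {ι : Type} {μ : Measure (EuclideanSpace ℝ ι)}

/-- **THE UPPER LETTER OF THE NEXT POTENTIAL FOR A BLOCK-LOCAL INPUT.**  `U : ℝ^ι → ℝ` with the upper letter along `δ`,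
`U(φ + δ) ≤ U(φ) + D(φ) + c` for every `φ` (any `D`, e.g. `DU(φ)[δ]`, and `c`, e.g. `½Λ·q(δ)`), the weights `e^{−U(ω+ψ)}`,
`e^{−U(ω+ψ)}D(ω+ψ)`, `e^{−U(ω+ψ+δ)}` integrable and `0 < Z(ψ)` ⟹ `0 < Z(ψ+δ)` and
`−log Z(ψ+δ) ≤ −log Z(ψ) + ⟨D(·+ψ)⟩_{ν_ψ} + c`, `Z(ψ) = ∫e^{−U(ω+ψ)}dμ`. [folklore] -/
theorem block_upper_letter (U D : EuclideanSpace ℝ ι → ℝ) {c : ℝ} (δ : EuclideanSpace ℝ ι) (hU : ∀ φ, U (φ + δ) ≤ U φ + D φ + c)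
    (ψ : EuclideanSpace ℝ ι) (hI : Integrable (fun ω => Real.exp (-U (ω + ψ))) μ)
    (hID : Integrable (fun ω => Real.exp (-U (ω + ψ)) * D (ω + ψ)) μ) (hI' : Integrable (fun ω => Real.exp (-U (ω + (ψ + δ)))) μ)
    (hZ : 0 < ∫ ω, Real.exp (-U (ω + ψ)) ∂μ) :
    0 < ∫ ω, Real.exp (-U (ω + (ψ + δ))) ∂μ ∧
      -Real.log (∫ ω, Real.exp (-U (ω + (ψ + δ))) ∂μ) ≤
        -Real.log (∫ ω, Real.exp (-U (ω + ψ)) ∂μ) +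
          (∫ ω, Real.exp (-U (ω + ψ)) * D (ω + ψ) ∂μ) / (∫ ω, Real.exp (-U (ω + ψ)) ∂μ) + c :=
  neg_log_upper_transfer (F := fun ω => U (ω + ψ)) (F' := fun ω => U (ω + (ψ + δ))) (G := fun ω => D (ω + ψ))
    (fun ω => by have h := hU (ω + ψ); rwa [add_assoc] at h) hI hID hI' hZ

end Block

/-! ## §3. Toy -/

/-- Toy (§1's tangent line at `0`): `1 + x ≤ e^{x}`. -/
example (x : ℝ) : Real.exp 0 * (1 + (x - 0)) ≤ Real.exp x := by
  have h := Real.add_one_le_exp x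
  rw [Real.exp_zero, one_mul, sub_zero]; linarith

end Summit.QuantumFields.BalabanUV.T4Continuum.NE7b.SupBlockUpperLetterTransfer
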